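import Summits.CriticalPhenomena.PercolationContinuityZ3.Theorems.PercNearOneGluingNoHeavyLowerTailSahiTangentAllOrders

/-!
# `NoHeavyLowerTail` (crux stmt-CriticalPhenomena-4575), Sahi programme: the all-orders contraction / tangent inequality on a chain for
# monotone FUNCTIONS (finite layer cake on `Bool × α`)

Support file (Sahi cell, seat `prim-sahi-p1`, generation 47; `--supports stmt-CriticalPhenomena-4575`); part 5 of the tangent files.  Pure proofs,
NO definitions, no `sorry`, standard axioms.

`…SahiTangentAllOrders.sahiE_coin_chain_ge` states the contraction inequality `p · E_n^{μ}(F(⊤,·)) ≤ E_n^{B_p⊗μ}(F)` on a finite chain for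
indicators `F_l = χ_{W_l}` of up-sets `W_l` of `Bool × α` (written as pairs `U_l⁰ ⊆ U_l¹` of up-sets of `α`).  Both sides are multilinear in
`(F_0,…,F_{n−1})`, so the finite layer cake (`exists_upperSet_decomposition` on `Bool × α`) gives the statement for all nonnegative monotone
`F_l : Bool × α → ℝ` — the routine step recorded here (`sahiE_coin_chain_ge_of_monotone`), following the pattern of
`Literature…Sahi2008.sahiE_nonneg_of_indicators_aux`.  Nothing conjectural is asserted. [this work]
-/

namespace Summit.CriticalPhenomena.PercolationContinuityZ3.Theorems.SahiTangent

open Finset Function Literature.Combinatorics.Sahi2008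
open scoped BigOperators

variable {α : Type*} [Fintype α] [DecidableEq α]

/-- Sections of an up-set of `Bool × α`: `χ_W(ε,x) = (ε ? χ_{W¹}(x) : χ_{W⁰}(x))` with `W^ε = {x : (ε,x) ∈ W}`. [this work] -/
theorem setInd_prod_eq_pair (W : Finset (Bool × α)) :
    (setInd W : Bool × α → ℝ) = fun z => if z.1 then setInd (univ.filter fun x => (true, x) ∈ W) z.2
      else setInd (univ.filter fun x => (false, x) ∈ W) z.2 := by
  funext z
  rcases z with ⟨c, x⟩
  cases c <;> simp [setInd_apply]

/-- The top section of a layer-cake sum is the layer-cake sum of the top sections. [this work] -/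
theorem top_section_listSum (l : List (ℝ × Finset (Bool × α))) :
    (fun x : α => (l.map fun q => q.1 • (setInd q.2 : Bool × α → ℝ)).sum (true, x)) =
      ((l.map fun q => (q.1, univ.filter fun x : α => (true, x) ∈ q.2)).map fun q => q.1 • setInd q.2).sum := by
  induction l with
  | nil => funext x; simp
  | cons q l ih =>
    funext x
    rw [List.map_cons, List.sum_cons, List.map_cons, List.map_cons, List.sum_cons, ← ih]
    simp [setInd_apply]

variable [LinearOrder α]

/-- The reduction step: if the inequality holds whenever the slots `≥ m` are indicators of up-sets of `Bool × α`, with the other slots nonnegative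
monotone, then it holds outright (layer cake in one slot at a time). [this work] -/
theorem sahiE_coin_chain_ge_aux {μ : α → ℝ} (hμ₀ : ∀ x, 0 ≤ μ x) (hμ₁ : ∑ x, μ x = 1) {p : ℝ} (hp₀ : 0 ≤ p) (hp₁ : p ≤ 1) (n : ℕ) :
    ∀ (m : ℕ) (F : Fin n → Bool × α → ℝ), (∀ l z, 0 ≤ F l z) → (∀ l, Monotone (F l)) →
      (∀ l : Fin n, m ≤ l.val → ∃ W : Finset (Bool × α), IsUpperSet ((W : Finset (Bool × α)) : Set (Bool × α)) ∧ F l = setInd W) →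
      p * sahiE μ n (fun l x => F l (true, x)) ≤
        sahiE (fun z : Bool × α => if z.1 then p * μ z.2 else (1 - p) * μ z.2) n F
  | 0, F, _, _, hind => by
    choose W hW hFW using fun l => hind l (Nat.zero_le _)
    have hF : F = fun l (z : Bool × α) => if z.1 then setInd (univ.filter fun x => (true, x) ∈ W l) z.2
        else setInd (univ.filter fun x => (false, x) ∈ W l) z.2 := by
      funext l; rw [hFW l, setInd_prod_eq_pair]
    have hFtop : (fun l (x : α) => F l (true, x)) = fun l => setInd (univ.filter fun x => (true, x) ∈ W l) := by
      funext l x; rw [hFW l]; simp [setInd_apply]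
    rw [hFtop, hF]
    refine sahiE_coin_chain_ge hμ₀ hμ₁ hp₀ hp₁ _ _ (fun l => ?_) (fun l => ?_) (fun l => ?_)
    · intro x y hxy hx
      rw [Finset.mem_coe, Finset.mem_filter] at hx ⊢
      exact ⟨mem_univ _, hW l (show ((false, x) : Bool × α) ≤ (false, y) from ⟨le_rfl, hxy⟩) hx.2⟩
    · intro x y hxy hx
      rw [Finset.mem_coe, Finset.mem_filter] at hx ⊢
      exact ⟨mem_univ _, hW l (show ((true, x) : Bool × α) ≤ (true, y) from ⟨le_rfl, hxy⟩) hx.2⟩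
    · intro x hx
      rw [Finset.mem_filter] at hx ⊢
      exact ⟨mem_univ _, hW l (show ((false, x) : Bool × α) ≤ (true, x) from ⟨Bool.false_le true, le_rfl⟩) hx.2⟩
  | m + 1, F, hF, hmono, hind => by
    by_cases hm : m < n
    · let i : Fin n := ⟨m, hm⟩
      obtain ⟨l, hl, hFl⟩ := exists_upperSet_decomposition (F i) (hF i) (hmono i)
      -- expand slot `i` on both sides
      have hR : sahiE (fun z : Bool × α => if z.1 then p * μ z.2 else (1 - p) * μ z.2) n F =
          (l.map fun q => q.1 * sahiE (fun z : Bool × α => if z.1 then p * μ z.2 else (1 - p) * μ z.2) n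
            (update F i (setInd q.2))).sum := by
        conv_lhs => rw [← update_eq_self i F, hFl]
        rw [sahiE_update_listSum]
      have hL : sahiE μ n (fun l x => F l (true, x)) =
          (l.map fun q => q.1 * sahiE μ n (fun l' x => (update F i (setInd q.2 : Bool × α → ℝ)) l' (true, x))).sum := by
        have e1 : (fun l' (x : α) => F l' (true, x)) =
            update (fun l' (x : α) => F l' (true, x)) i (fun x => (l.map fun q => q.1 • (setInd q.2 : Bool × α → ℝ)).sum (true, x)) := by
          funext l' x
          by_cases hli : l' = i
          · subst hli; rw [update_self, ← hFl]
          · rw [update_of_ne hli]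
        rw [e1, top_section_listSum, sahiE_update_listSum, List.map_map]
        congr 1
        refine List.map_congr_left fun q _ => ?_
        simp only [Function.comp_apply]
        congr 2
        funext l' x
        by_cases hli : l' = i
        · subst hli; rw [update_self, update_self]; simp [setInd_apply]
        · rw [update_of_ne hli, update_of_ne hli]
      rw [hR, hL, ← List.sum_map_mul_left]
      refine List.sum_le_sum fun q hq => ?_
      have hq0 : 0 ≤ q.1 := (hl q hq).1
      have ih := sahiE_coin_chain_ge_aux hμ₀ hμ₁ hp₀ hp₁ n m (update F i (setInd q.2)) ?_ ?_ ?_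
      · calc p * (q.1 * sahiE μ n (fun l' x => update F i (setInd q.2 : Bool × α → ℝ) l' (true, x)))
            = q.1 * (p * sahiE μ n (fun l' x => update F i (setInd q.2 : Bool × α → ℝ) l' (true, x))) := by ring
          _ ≤ q.1 * sahiE (fun z : Bool × α => if z.1 then p * μ z.2 else (1 - p) * μ z.2) n (update F i (setInd q.2)) :=
            mul_le_mul_of_nonneg_left ih hq0
      · intro j z
        by_cases hji : j = i
        · subst hji; rw [update_self]; exact setInd_nonneg _ _
        · rw [update_of_ne hji]; exact hF j z
      · intro j
        by_cases hji : j = i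
        · subst hji; rw [update_self]; exact monotone_setInd (hl q hq).2
        · rw [update_of_ne hji]; exact hmono j
      · intro j hmj
        by_cases hji : j = i
        · subst hji
          exact ⟨q.2, (hl q hq).2, by rw [update_self]⟩
        · have hij : m + 1 ≤ j.val := by
            have : j.val ≠ m := fun hv => hji (Fin.ext hv)
            omega
          obtain ⟨W, hW, hjW⟩ := hind j hij
          exact ⟨W, hW, by rw [update_of_ne hji]; exact hjW⟩
    · exact sahiE_coin_chain_ge_aux hμ₀ hμ₁ hp₀ hp₁ n m F hF hmono fun l hl => absurd hl (by omega)

/-- **The contraction / tangent inequality on a chain, every order, for monotone FUNCTIONS.**  For a probability weight `μ` on a finite linear order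
`α`, `p ∈ [0,1]`, every `n` and all nonnegative monotone `F_l : Bool × α → ℝ` (product order):
`p · E_n^{μ}(F_0(⊤,·),…,F_{n−1}(⊤,·)) ≤ E_n^{B_p⊗μ}(F_0,…,F_{n−1})` — i.e. `E_n ≥ P(ε=1)·E_n(· | ε=1)` and `p ↦ E_n^{B_p⊗μ}(F)/p` is non-increasing.
(`sahiE_coin_chain_ge` + the finite layer cake on `Bool × α`.) [this work] -/
theorem sahiE_coin_chain_ge_of_monotone {μ : α → ℝ} (hμ₀ : ∀ x, 0 ≤ μ x) (hμ₁ : ∑ x, μ x = 1) {p : ℝ} (hp₀ : 0 ≤ p) (hp₁ : p ≤ 1)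
    {n : ℕ} (F : Fin n → Bool × α → ℝ) (hF0 : ∀ l z, 0 ≤ F l z) (hFm : ∀ l, Monotone (F l)) :
    p * sahiE μ n (fun l x => F l (true, x)) ≤
      sahiE (fun z : Bool × α => if z.1 then p * μ z.2 else (1 - p) * μ z.2) n F :=
  sahiE_coin_chain_ge_aux hμ₀ hμ₁ hp₀ hp₁ n n F hF0 hFm fun l hl => absurd hl (by omega)

end Summit.CriticalPhenomena.PercolationContinuityZ3.Theorems.SahiTangent
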